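import Summits.QuantumFields.YangMills.Theorems.BalabanUVNodesN07CritCfgAxOfRecordClauses
import Summits.QuantumFields.YangMills.Theorems.BalabanUVNodesN09RegularOnOfLoopSmallThresholdsAnyCrit
import Summits.QuantumFields.YangMills.Theorems.BalabanUVNodesN09DensityContinuousOffThresholdsAnyCrit
import Literature.MathematicalPhysics.QuantumFieldTheory.Balaban1983to89.Node00.Record13Ax

/-!
# BalabanUVNodes ∕ N07–N09 junction — ROAD B (`hreg`) FOR THE RE-CENTRED β-INPUT OF RECORD: densities cut at the (2.9) thresholds of RC-1's NAMED block-axial critical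
# configuration `critCfgAxOfRecord` — the Ax EDITION of dag-n09-w2∕w3's one-step door `domAlt_{j+1} ⊆ regSetOfRecord K j ρ_j^{Ax} ∧ HasContTransportOn …`, with the letter's
# continuity clause DISCHARGED from [B11] Thm 1's two-radii binders (this seat's `…N07CritCfgAxOfRecordClauses`) and (H-U) ∕ (I19) ∕ `GF_j`, `A_j` continuity displayed

Cell `pub-ymgap` (YM-PLAN Track A, D-0062), width seat `pub-ymgap-dag-n07-w3` (g22; node N07 = [Balaban1985Variational] ∕ K0–K1 junction).  `--kind proof --supports
stmt-QuantumFields-27239 --as helper` (K1ᴬ `StabilityBRunRowsAtRecordR13SepCoPHVAx`, the live re-centred deciding crux since route rev 31∕32; K1⁹ 27364 is its aside), COUNT-NEUTRAL.  NEW leaf; THEOREMS ONLY — 0 `def`, 0 `sorry`, 0 `instance`, 0 `notation`; standard axioms.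
[I] = [Balaban1987RG1] (CMP 109), [B7] = [Balaban1985Averaging] (CMP 98), [B11] = [Balaban1985Variational] (CMP 102).

WHY.  Road B of node N09 (the analytic inclusion `hreg : domAlt_{j+1} ⊆ regSetOfRecord K j ρ_j` of the `hreg` towers ∕ (F3) ∕ `contTOn`) is letter-parametric since dag-n09-w3 g6
(`…N09RegularOnOfLoopSmallThresholdsAnyCrit`, `…N09DensityContinuousOffThresholdsAnyCrit`, `…N09LocalSupportSetAnyCrit`): for ANY critical letter `crit` it asks the fibre identity,
[B7] Prop-2 smallness and `ContinuousOn crit` on the domain, plus (H-U) measurability, (I19) integrability and the continuity of `GF_j`, `A_j`.  The bare edition's `hcrit` is unprovable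
(`Classical.choose`); the Sel edition's is dag-n09-w1 g6's theorem; after WORK ORDER RC-1 (director-ym №462∕№467) the β-slot χ of the line-to-be is `[Ax-3a]`'s `chiβOfRecord₁₃Ax θ =
chiFixed29Ax θ.ν θ.ε₂₉` — the (2.9) cut-off centred at the NAMED `critCfgAxOfRecord` — whose `hcrit` is this seat's `continuousOn_critCfgAxOfRecord_of_thm1_of_reg8`.  THIS FILE is the
Ax EDITION of the one-step road, by name:
* §1 faces of the Ax β-input `ρ_k^{Ax} = betaInputOfRecord T (chiFixed29Ax ν ε₁) K g k = χ^{(2.9)}_{k,ax}·exp[−GF_k∕g_k² + A_k]` (`_apply` rfl, `chiFix29AxOfRecord_le_one`, `_nonneg`, `_pos_iff`).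
* §2 the engine's LOCAL clauses for the Ax letter: ★ `hρc_betaInput_chi29Ax_local_of_continuousOn_crit` (continuity off the Ax thresholds, from `ContinuousOn (critCfgAxOfRecord ν K k) D`),
  `hρC_betaInput_chi29Ax_of_continuousOn` (boundedness on a closed `K₀`), ★ `hρK_betaInput_chi29Ax_of_fibre_of_plaqSmall` ∕ ★★ `…_of_hsol_of_numerics` (the local support clause at
  `D := domAlt_{k+1}` from the fibre identity `avg_critCfgAxOfRecord` + Prop-2 smallness `plaqSmall_critCfgAxOfRecord_of_ukExists` + the p. 267 rider numerics).
* §3 ★★ `regularOn_of_loopSmall_chi29Ax_local` ∕ `domAlt_subset_regSetOfRecord_of_loopSmall_chi29Ax_local` — dag-n09-w3 g6's localised door AT `crit := critCfgAxOfRecord ν K k`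
  (exemption read through `Node00.fluctDevAxOfRecord`).
* §4 ★★★ `regularOn_domAlt_betaInput_chi29Ax_of_thm1_of_reg8` — ONE STEP `j < K` OF ROAD B FOR THE Ax β-INPUT with every support binder supplied and `hcrit` DISCHARGED:
  `domAlt_{j+1} ⊆ regSetOfRecord F N K j ρ_j^{Ax} ∧ HasContTransportOn F N K j ρ_j^{Ax} domAlt_{j+1}` from (H-U) `hρm`, (I19) `hint`, the two-radii [B11] binders on `domAlt_{j+1}`
  (`h11` : Thm 1 ×2 at `εbg`, `hreg8` : (8)-membership at `εreg`), `GF_j` ∕ `A_j` continuous on `domAlt_j`, and NUMERICS ONLY (dag-n09-w2's list: `0 < εreg`, (53) ×2 at `εreg`, `0 < ε₂₉`,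
  rider ×2, `(((d+2)L)²∕4)·B < α ≤ 1∕24`, `α < δ_N`, `157·α < L^{1−d}`, STRICT `B < ε₀`; dag-n09-w1's: `εreg < εbg`, `εreg < α₀`, `α₀` admissible (53) + two loop-guard rows; the
  Federbush letter `((d·L)²∕4)·(2εreg∕L²) < δ_N^{Fed}`); ★★★ `hregAx_of_thm1_εbg_of_reg8` — the doors' binder for every step of a torus `K` at the Stage-13 Ax letters
  (`chiβOfRecord₁₃Ax θ`, any transport `T`, any history `g`), from the tower-shaped binders `h11`∕`hreg8` (`∀ k ≤ K, ∀ V ∈ domAlt_k, …`), (H-U), (I19), `GF`∕`A` continuity, numerics.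

HONEST FRAMING (binding).  Count-neutral kernel assembly BY NAME over dag-n09-w1∕w2∕w3∕w4∕w5's road-B theorems, PT-A-2's [Ax-2]∕[Ax-3a] names and this seat's file 1; [B11] Theorem 1
enters ONLY as the displayed two-radii binders; (H-U) measurability of the Ax β-input STAYS DISPLAYED (file 1's located note: it is a theorem only under uniqueness of the minimal orbit
at every coarse field), (I19) and the `GF_j`∕`A_j` continuity rows stay displayed; NOTHING of Bałaban's analysis asserted or discharged; no body of record edited, no name re-pointed;
`hreg` ∕ (F3) ∕ `contTOn` NOT discharged for any record; N07 ∕ N09 NOT discharged; K0⁷ ∕ K1⁹ ∕ K3⁸ and the unborn K-Ax texts NOT closed; counts unmoved (8∕28 · K 1∕4); one finite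
four-torus programme at fixed `ε = L^{−K}` per run — R4 closes the CONDITIONAL rung `BalabanLadder.UV` only; NOT ℝ⁴ ∕ infinite volume ∕ OS; the Yang–Mills mass gap (Clay) is NOT
proved by any of this.
-/

noncomputable section

open scoped Matrix.Norms.L2Operator Topology
open Set Filter Function MeasureTheory

namespace Summit.QuantumFields.YangMills.BalabanUVNodes.N07RoadBHregChi29AxOfRecord

open Literature.MathematicalPhysics.QuantumFieldTheory.Balaban1983to89
open Literature.MathematicalPhysics.QuantumFieldTheory.Balaban1983to89.Node00
open Literature.MathematicalPhysics.QuantumFieldTheory.Balaban1983to89.T4Continuum (T4Family)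
open Literature.MathematicalPhysics.QuantumFieldTheory.Balaban1983to89.BlockAveraging (Idx loopHol)
open Literature.MathematicalPhysics.QuantumFieldTheory.Balaban1983to89.BlockAveragingHaarAC (centralBond)
open Literature.MathematicalPhysics.QuantumFieldTheory.Balaban1983to89.ExpMeanLog (deltaSU)
open Literature.MathematicalPhysics.QuantumFieldTheory.Balaban1983to89.FederbushMean (deltaFed)
open B12ContinuousTransportInvarianceOn (isOpen_domAltOfRecord)
open Summit.QuantumFields.YangMills.BalabanUVNodes.N07CritCfgAxOfRecordClauses
  (plaqSmall_critCfgAxOfRecord_of_ukExists continuousOn_critCfgAxOfRecord_of_thm1_of_reg8)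
open Summit.QuantumFields.YangMills.BalabanUVNodes.N09RegularOnOfLoopSmallThresholdsAnyCrit (regularOn_of_loopSmall_thresholds_local)
open Summit.QuantumFields.YangMills.BalabanUVNodes.N09DensityContinuousOffThresholdsAnyCrit (hρc_local_of_continuousOn_crit hρC_of_cut_le_one_of_continuousOn)
open Summit.QuantumFields.YangMills.BalabanUVNodes.N09LocalSupportSetAnyCrit (hρK_of_thresholds)
open Summit.QuantumFields.YangMills.BalabanUVNodes.N09LocalSupportSetAtRecord
  (isClosed_loopLe_inter_plaqLe localSupportSet_subset_loopGuard plaqSmall_of_mem_of_lt)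
open Summit.QuantumFields.YangMills.BalabanUVNodes.N09BackgroundRadiiTransfer (ukExists_of_le_of_Uk_mem)

variable {F : T4Family} {N : ℕ} [NeZero N] {K k : ℕ}

/-! ## §1  Faces of the Ax β-input `ρ_k^{Ax} = χ^{(2.9)}_{k,ax}·exp[−GF_k∕g_k² + A_k]` -/

/-- Unfolding (`rfl`): the β-input at the re-centred (2.9) species. [cite: Balaban1987RG1, (0.19) p.255 and (2.9) p.266 (bookkeeping)] -/
theorem betaInput_chi29Ax_apply (ν : Stage7Numerics) (ε₁ : ℝ) (T : Transport F N) (K : ℕ) (g : ℕ → ℝ) (k : ℕ) (U : GaugeField (F.P K) k (SU N)) :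
    betaInputOfRecord F N T (chiFixed29Ax F N ν ε₁) K g k U
      = chiFix29AxOfRecord F N ν ε₁ K k U * Real.exp (-(1 / (g k) ^ 2) * gfOfRecord F N K k U + effActionHT F N T (chiFixed29Ax F N ν ε₁) K g k U) := rfl

/-- `χ^{(2.9)}_{k,ax} ≤ 1`. [cite: Balaban1987RG1, (2.9) p.266 (bookkeeping)] -/
theorem chiFix29AxOfRecord_le_one (ν : Stage7Numerics) (ε₁ : ℝ) (K k : ℕ) (V : GaugeField (F.P K) k (SU N)) : chiFix29AxOfRecord F N ν ε₁ K k V ≤ 1 := by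
  rcases chiFix29AxOfRecord_eq_zero_or_one ν ε₁ K k V with h | h <;> rw [h]
  exact zero_le_one

/-- The Ax β-input is non-negative (`χ^{(2.9)}_{ax} ∈ {0,1}`, `exp > 0`). [cite: Balaban1987RG1, (0.19) p.255 (bookkeeping)] -/
theorem betaInput_chi29Ax_nonneg (ν : Stage7Numerics) (ε₁ : ℝ) (T : Transport F N) (K : ℕ) (g : ℕ → ℝ) (k : ℕ) (U : GaugeField (F.P K) k (SU N)) :
    0 ≤ betaInputOfRecord F N T (chiFixed29Ax F N ν ε₁) K g k U := by
  rw [betaInput_chi29Ax_apply]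
  have hχ : 0 ≤ chiFix29AxOfRecord F N ν ε₁ K k U := by
    rcases chiFix29AxOfRecord_eq_zero_or_one ν ε₁ K k U with h | h <;> rw [h]
    exact zero_le_one
  exact mul_nonneg hχ (Real.exp_pos _).le

/-- **The Ax β-input is POSITIVE exactly where `χ^{(2.9)}_{k,ax} = 1`.** [cite: Balaban1987RG1, (0.19) p.255 and (2.9) p.266] -/
theorem betaInput_chi29Ax_pos_iff (ν : Stage7Numerics) (ε₁ : ℝ) (T : Transport F N) (K : ℕ) (g : ℕ → ℝ) (k : ℕ) (U : GaugeField (F.P K) k (SU N)) :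
    0 < betaInputOfRecord F N T (chiFixed29Ax F N ν ε₁) K g k U ↔ chiFix29AxOfRecord F N ν ε₁ K k U = 1 := by
  rw [betaInput_chi29Ax_apply]
  rcases chiFix29AxOfRecord_eq_zero_or_one ν ε₁ K k U with h | h <;> rw [h]
  · simp
  · simp [Real.exp_pos]

/-- `ρ_k^{Ax} U ≠ 0` forces every non-distinguished Ax threshold at `U` below `ε₁` (the (2.9) cut-off of the named letter is a factor of `ρ_k^{Ax}`).
[cite: Balaban1987RG1, (0.19) p.255 and (2.9) p.266] -/
theorem thresholds_of_betaInput_chi29Ax_ne_zero (ν : Stage7Numerics) (ε₁ : ℝ) (T : Transport F N) (K : ℕ) (g : ℕ → ℝ) (k : ℕ)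
    (U : GaugeField (F.P K) k (SU N)) (hρ : betaInputOfRecord F N T (chiFixed29Ax F N ν ε₁) K g k U ≠ 0) :
    ∀ b : PBond (F.P K) k, ¬ IsB0 b → dist1 ((critCfgAxOfRecord F N ν K k ((avOfRecord F N K k).avg U) b)⁻¹ * U b) < ε₁ := by
  intro b hb
  have hpos : 0 < betaInputOfRecord F N T (chiFixed29Ax F N ν ε₁) K g k U := lt_of_le_of_ne (betaInput_chi29Ax_nonneg ν ε₁ T K g k U) (Ne.symm hρ)
  have h := (chiFix29AxOfRecord_eq_one_iff ν ε₁ K k U).1 ((betaInput_chi29Ax_pos_iff ν ε₁ T K g k U).1 hpos) b hb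
  rwa [fluctDevAxOfRecord_apply] at h

/-! ## §2  The engine's LOCAL clauses for the Ax letter: continuity off the thresholds, boundedness, the local support clause -/

/-- ★ **Ax EDITION of the LOCAL continuity clause**: `ρ_k := betaInputOfRecord T (chiFixed29Ax ν ε₁) K g k`, exemption via `Node00.fluctDevAxOfRecord`; the letter's continuity
`hcrit : ContinuousOn (critCfgAxOfRecord ν K k) D` is this seat's file-1 theorem at `D := domAlt_{k+1}` from [B11] Thm 1's two-radii binders (dag-n09-w3's generic
`hρc_local_of_continuousOn_crit` at `crit := critCfgAxOfRecord ν K k`). [cite: Balaban1987RG1, (0.19) p.255, (2.3) p.265 and (2.9) p.266; Balaban1985Variational, Thm 1 p.279] -/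
theorem hρc_betaInput_chi29Ax_local_of_continuousOn_crit (ν : Stage7Numerics) (ε₁ : ℝ) (T : Transport F N) (g : ℕ → ℝ)
    {K₀ Dk : Set (GaugeField (F.P K) k (SU N))} {D : Set (GaugeField (F.P K) (k + 1) (SU N))} (hD : IsOpen D) (hDk : IsOpen Dk) (hK₀Dk : K₀ ⊆ Dk)
    {α : ℝ} (hαδ : α < deltaSU (Fin N)) (hK₀α : ∀ U ∈ K₀, ∀ c (i : Idx (F.P K)), dist1 (loopHol U c i) ≤ α)
    (hcrit : ContinuousOn (critCfgAxOfRecord F N ν K k) D)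
    (hGF : ContinuousOn (gfOfRecord F N K k) Dk) (hA : ContinuousOn (effActionHT F N T (chiFixed29Ax F N ν ε₁) K g k) Dk) :
    ∀ U ∈ K₀, (avOfRecord F N K k).avg U ∈ D →
      (∀ b : PBond (F.P K) k, (∀ c : PBond (F.P K) (k + 1), centralBond c ≠ b) → fluctDevAxOfRecord F N ν K k U b ≠ ε₁) →
        ContinuousAt (betaInputOfRecord F N T (chiFixed29Ax F N ν ε₁) K g k) U := by
  intro U hU hUD hne
  refine hρc_local_of_continuousOn_crit (crit := critCfgAxOfRecord F N ν K k) (χ := chiFix29AxOfRecord F N ν ε₁ K k)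
    (GF := gfOfRecord F N K k) (A := effActionHT F N T (chiFixed29Ax F N ν ε₁) K g k) (gk := g k) (fun _ => rfl)
    (fun V hV => (chiFix29AxOfRecord_eq_one_iff ν ε₁ K k V).2 fun b hb => by rw [fluctDevAxOfRecord_apply]; exact hV b hb)
    (fun V hV => ?_) hD hDk hK₀Dk hαδ hK₀α hcrit hGF hA U hU hUD (fun b hb => by rw [← fluctDevAxOfRecord_apply]; exact hne b hb)
  rcases chiFix29AxOfRecord_eq_zero_or_one ν ε₁ K k V with h | h
  · exact h
  · exact absurd (fun b hb => by rw [← fluctDevAxOfRecord_apply]; exact (chiFix29AxOfRecord_eq_one_iff ν ε₁ K k V).1 h b hb) hV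

omit [NeZero N] in
/-- **Ax EDITION of the boundedness clause** (`0 ≤ χ^{(2.9)}_{ax} ≤ 1`; compactness of `SU(N)^{bonds}`). [cite: Balaban1987RG1, (0.19) p.255 (bookkeeping)] -/
theorem hρC_betaInput_chi29Ax_of_continuousOn [NeZero N] (ν : Stage7Numerics) (ε₁ : ℝ) (T : Transport F N) (g : ℕ → ℝ)
    {K₀ Dk : Set (GaugeField (F.P K) k (SU N))} (hK₀ : IsClosed K₀) (hK₀Dk : K₀ ⊆ Dk)
    (hGF : ContinuousOn (gfOfRecord F N K k) Dk) (hA : ContinuousOn (effActionHT F N T (chiFixed29Ax F N ν ε₁) K g k) Dk) :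
    ∃ C₀ : ℝ, ∀ U ∈ K₀, betaInputOfRecord F N T (chiFixed29Ax F N ν ε₁) K g k U ≤ C₀ :=
  hρC_of_cut_le_one_of_continuousOn (χ := chiFix29AxOfRecord F N ν ε₁ K k) (gk := g k) (fun _ => rfl)
    (fun V => chiFix29AxOfRecord_le_one ν ε₁ K k V) hK₀ hK₀Dk hGF hA

/-- ★ **Ax EDITION of the local SUPPORT clause, Prop-2 smallness displayed**: `crit := critCfgAxOfRecord ν K k`, `D := domAltOfRecord ν K (k+1)`; the fibre identity is PT-A-2's
`avg_critCfgAxOfRecord` under solvability `hsol`; `PlaqSmall δ (critCfgAxOfRecord ν K k W)` on the domain DISPLAYED; then dag-n09-w3's `hρK_of_thresholds` for the Ax β-input.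
[cite: Balaban1987RG1, (0.19) p.255, (2.3) p.265, (2.9) p.266 and p.267; Balaban1985Variational, Thm 1 p.279] -/
theorem hρK_betaInput_chi29Ax_of_fibre_of_plaqSmall (ν : Stage7Numerics) (hk : k < K) (T : Transport F N) (g : ℕ → ℝ) {ε₁ δ : ℝ} (hε : 0 ≤ ε₁) (hδ : 0 ≤ δ)
    (hn1 : 1640 * (2 * (((((F.P K).d + 2) * (F.P K).L : ℕ) : ℝ) * ε₁) + ((((F.P K).d + 2) * (F.P K).L : ℕ) : ℝ) ^ 2 / 4 * δ) *
      (((F.P K).L : ℝ) ^ ((F.P K).d - 1)) ^ 2 ≤ 1)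
    (hn2 : 13 * (2 * (((((F.P K).d + 2) * (F.P K).L : ℕ) : ℝ) * ε₁) + ((((F.P K).d + 2) * (F.P K).L : ℕ) : ℝ) ^ 2 / 4 * δ) *
      ((F.P K).L : ℝ) ^ ((F.P K).d - 1) < deltaSU (Fin N))
    {α : ℝ} (hαB : ((((F.P K).d + 2) * (F.P K).L : ℕ) : ℝ) ^ 2 / 4 *
      (δ + 4 * max ε₁ (10 * (((((F.P K).d + 2) * (F.P K).L : ℕ) : ℝ) * ε₁) * ((F.P K).L : ℝ) ^ ((F.P K).d - 1))) < α)
    (hsol : ∀ W ∈ domAltOfRecord F N ν K (k + 1), UkExists F N K (k + 1) ν.εreg W)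
    (hcritδ : ∀ W ∈ domAltOfRecord F N ν K (k + 1), PlaqSmall δ (critCfgAxOfRecord F N ν K k W)) :
    ∀ U : GaugeField (F.P K) k (SU N), (avOfRecord F N K k).avg U ∈ domAltOfRecord F N ν K (k + 1) →
      betaInputOfRecord F N T (chiFixed29Ax F N ν ε₁) K g k U ≠ 0 →
        U ∈ interior {W : GaugeField (F.P K) k (SU N) | (∀ c i, dist1 (loopHol W c i) ≤ α) ∧ ∀ p, dist1 (GaugeField.plaqHol W p) ≤
          δ + 4 * max ε₁ (10 * (((((F.P K).d + 2) * (F.P K).L : ℕ) : ℝ) * ε₁) * ((F.P K).L : ℝ) ^ ((F.P K).d - 1))} := by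
  have hj : k + 1 ≤ (F.P K).m + (F.P K).K := by simp only [T4Family.P_K]; omega
  exact hρK_of_thresholds (critCfgAxOfRecord F N ν K k) hk hε hδ hn1 hn2 hαB
    (fun W hW => avg_critCfgAxOfRecord hj (hsol W hW)) hcritδ
    (fun U hρ => thresholds_of_betaInput_chi29Ax_ne_zero ν ε₁ T K g k U hρ)

/-- ★★ **Ax EDITION of the local SUPPORT clause FROM SOLVABILITY + NUMERICS ONLY** (`δ := 2εreg∕L²`, Prop-2 smallness of the named letter by file 1's
`plaqSmall_critCfgAxOfRecord_of_ukExists`). [cite: Balaban1987RG1, (0.19) p.255, (2.3) p.265, (2.9) p.266 and p.267; Balaban1985Averaging, Prop. 2 (53) p.26] -/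
theorem hρK_betaInput_chi29Ax_of_hsol_of_numerics (ν : Stage7Numerics) (hk : k < K) (T : Transport F N) (g : ℕ → ℝ) {ε₁ : ℝ} (hε : 0 ≤ ε₁)
    (hεreg : 0 < ν.εreg)
    (hε3 : (143 * (((((F.P K).d + 4 : ℕ) : ℝ)) ^ 2 / 4) ^ 2) * ν.εreg ≤ 1 / 3)
    (hε2 : 2 * ν.εreg ≤ 2 * deltaSU (Fin N) / ((((F.P K).d + 4) * (F.P K).L : ℕ) : ℝ) ^ 2)
    (hn1 : 1640 * (2 * (((((F.P K).d + 2) * (F.P K).L : ℕ) : ℝ) * ε₁) + ((((F.P K).d + 2) * (F.P K).L : ℕ) : ℝ) ^ 2 / 4 * (2 * ν.εreg / ((F.P K).L : ℝ) ^ 2)) *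
      (((F.P K).L : ℝ) ^ ((F.P K).d - 1)) ^ 2 ≤ 1)
    (hn2 : 13 * (2 * (((((F.P K).d + 2) * (F.P K).L : ℕ) : ℝ) * ε₁) + ((((F.P K).d + 2) * (F.P K).L : ℕ) : ℝ) ^ 2 / 4 * (2 * ν.εreg / ((F.P K).L : ℝ) ^ 2)) *
      ((F.P K).L : ℝ) ^ ((F.P K).d - 1) < deltaSU (Fin N))
    {α : ℝ} (hαB : ((((F.P K).d + 2) * (F.P K).L : ℕ) : ℝ) ^ 2 / 4 *
      (2 * ν.εreg / ((F.P K).L : ℝ) ^ 2 + 4 * max ε₁ (10 * (((((F.P K).d + 2) * (F.P K).L : ℕ) : ℝ) * ε₁) * ((F.P K).L : ℝ) ^ ((F.P K).d - 1))) < α)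
    (hsol : ∀ W ∈ domAltOfRecord F N ν K (k + 1), UkExists F N K (k + 1) ν.εreg W) :
    ∀ U : GaugeField (F.P K) k (SU N), (avOfRecord F N K k).avg U ∈ domAltOfRecord F N ν K (k + 1) →
      betaInputOfRecord F N T (chiFixed29Ax F N ν ε₁) K g k U ≠ 0 →
        U ∈ interior {W : GaugeField (F.P K) k (SU N) | (∀ c i, dist1 (loopHol W c i) ≤ α) ∧ ∀ p, dist1 (GaugeField.plaqHol W p) ≤
          2 * ν.εreg / ((F.P K).L : ℝ) ^ 2 + 4 * max ε₁ (10 * (((((F.P K).d + 2) * (F.P K).L : ℕ) : ℝ) * ε₁) * ((F.P K).L : ℝ) ^ ((F.P K).d - 1))} :=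
  have hL0 : (0 : ℝ) < (F.P K).L := by exact_mod_cast (F.P K).L_pos
  hρK_betaInput_chi29Ax_of_fibre_of_plaqSmall ν hk T g hε (by positivity) hn1 hn2 hαB hsol
    fun W hW => plaqSmall_critCfgAxOfRecord_of_ukExists ν hεreg hε3 hε2 (by rw [div_mul_cancel₀ _ (by positivity)]) (hsol W hW)

/-! ## §3  dag-n09-w3 g6's localised door at `crit := critCfgAxOfRecord ν K k` -/

/-- ★★ **THE Ax EDITION: ROAD B LOCALISED FOR DENSITIES CUT AT THE NAMED LETTER's (2.9) THRESHOLDS** (`crit := critCfgAxOfRecord ν K k`, exemption read through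
`Node00.fluctDevAxOfRecord`): `D ⊆ regSetOfRecord F N K k ρ ∧ HasContTransportOn F N K k ρ D` from the engine's displayed clauses (`regularOn_of_loopSmall_thresholds_local`).
[cite: Balaban1987RG1, (0.13) p.254, p.259, (2.3) p.265, (2.9) p.266 and (2.10) p.267] -/
theorem regularOn_of_loopSmall_chi29Ax_local (ν : Stage7Numerics) (hk : k < K) {α : ℝ} (hα24 : α ≤ 1 / 24) (hαδ : α < deltaSU (Fin N))
    (hαL : 157 * α < (((F.P K).L : ℝ) ^ ((F.P K).d - 1))⁻¹) {ε₁ : ℝ} (hε : ε₁ ≠ 0) {ρ : Density (F.P K) k (SU N)}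
    (hρm : Measurable ρ) (hρi : Integrable ρ (fieldMeasure (F.P K) k (SU N))) (hρ0 : ∀ U, 0 ≤ ρ U)
    {D : Set (GaugeField (F.P K) (k + 1) (SU N))} (hD : IsOpen D)
    {K₀ : Set (GaugeField (F.P K) k (SU N))} (hK₀ : IsClosed K₀) (hK₀α : ∀ U ∈ K₀, ∀ c i, dist1 (loopHol U c i) ≤ α)
    (hρC : ∃ C₀ : ℝ, ∀ U ∈ K₀, ρ U ≤ C₀)
    (hρK : ∀ U, (avOfRecord F N K k).avg U ∈ D → ρ U ≠ 0 → U ∈ interior K₀)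
    (hρc : ∀ U ∈ K₀, (avOfRecord F N K k).avg U ∈ D →
      (∀ b : PBond (F.P K) k, (∀ c, centralBond c ≠ b) → fluctDevAxOfRecord F N ν K k U b ≠ ε₁) → ContinuousAt ρ U) :
    D ⊆ regSetOfRecord F N K k ρ ∧ HasContTransportOn F N K k ρ D :=
  regularOn_of_loopSmall_thresholds_local (critCfgAxOfRecord F N ν K k) hk hα24 hαδ hαL hε hρm hρi hρ0 hD hK₀ hK₀α hρC hρK
    (fun U hU hUD hQ => hρc U hU hUD fun b hb => by rw [fluctDevAxOfRecord_apply]; exact hQ b hb)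

/-- ★ **THE `hreg` SHAPE, Ax EDITION**: `domAltOfRecord F N ν' K (k+1) ⊆ regSetOfRecord F N K k ρ` (and the on-domain proviso) for every `ρ` as in
`regularOn_of_loopSmall_chi29Ax_local` at `D := domAltOfRecord ν' K (k+1)`. [cite: Balaban1987RG1, p.259, (2.9) p.266 and (2.10) p.267] -/
theorem domAlt_subset_regSetOfRecord_of_loopSmall_chi29Ax_local (ν ν' : Stage7Numerics) (hk : k < K) {α : ℝ} (hα24 : α ≤ 1 / 24)
    (hαδ : α < deltaSU (Fin N)) (hαL : 157 * α < (((F.P K).L : ℝ) ^ ((F.P K).d - 1))⁻¹) {ε₁ : ℝ} (hε : ε₁ ≠ 0)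
    {ρ : Density (F.P K) k (SU N)} (hρm : Measurable ρ) (hρi : Integrable ρ (fieldMeasure (F.P K) k (SU N))) (hρ0 : ∀ U, 0 ≤ ρ U)
    {K₀ : Set (GaugeField (F.P K) k (SU N))} (hK₀ : IsClosed K₀) (hK₀α : ∀ U ∈ K₀, ∀ c i, dist1 (loopHol U c i) ≤ α)
    (hρC : ∃ C₀ : ℝ, ∀ U ∈ K₀, ρ U ≤ C₀)
    (hρK : ∀ U, (avOfRecord F N K k).avg U ∈ domAltOfRecord F N ν' K (k + 1) → ρ U ≠ 0 → U ∈ interior K₀)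
    (hρc : ∀ U ∈ K₀, (avOfRecord F N K k).avg U ∈ domAltOfRecord F N ν' K (k + 1) →
      (∀ b : PBond (F.P K) k, (∀ c, centralBond c ≠ b) → fluctDevAxOfRecord F N ν K k U b ≠ ε₁) → ContinuousAt ρ U) :
    domAltOfRecord F N ν' K (k + 1) ⊆ regSetOfRecord F N K k ρ ∧ HasContTransportOn F N K k ρ (domAltOfRecord F N ν' K (k + 1)) :=
  regularOn_of_loopSmall_chi29Ax_local ν hk hα24 hαδ hαL hε hρm hρi hρ0 (isOpen_domAltOfRecord ν' K (k + 1)) hK₀ hK₀α hρC hρK hρc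

/-! ## §4  ONE STEP of road B for the Ax β-input with `hcrit` DISCHARGED from the two-radii [B11] binders; the doors' binder `hreg` at the Stage-13 Ax letters -/

/-- ★★★ **ONE STEP OF ROAD B FOR THE RE-CENTRED β-INPUT, EVERY SUPPORT BINDER SUPPLIED AND THE LETTER's CONTINUITY DISCHARGED** (`χ := chiFixed29Ax ν ε₂₉`; ANY transport `T`,
ANY history `g`; `j < K`): `domAlt_{j+1} ⊆ regSetOfRecord F N K j ρ_j^{Ax} ∧ HasContTransportOn F N K j ρ_j^{Ax} domAlt_{j+1}` from: (H-U) `hρm`, (I19) `hint`, the TWO-RADII [B11]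
binders on `domAlt_{j+1}` — `h11` ([B11] Thm 1 ×2 at the background radius `εbg`) and `hreg8` ((8)-membership `Uk εbg W ∈ bgReg εreg`) —, `GF_j` and `A_j` continuous on `domAlt_j`,
and NUMERICS (dag-n09-w2's one-step list: `0 < εreg`, (53) ×2 at `εreg`, `0 < ε₂₉`, rider ×2, `(((d+2)L)²∕4)·B < α ≤ 1∕24`, `α < δ_N`, `157·α < L^{1−d}`, STRICT `B < ε₀`; dag-n09-w1's:
`εreg < εbg`, `εreg < α₀`, `α₀` admissible (53) + the two loop-guard rows; the Federbush letter `((d·L)²∕4)·(2εreg∕L²) < δ_N^{Fed}`).  Assembly: §3 at the support set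
`K₀ = «loops ≤ α ∧ plaquettes ≤ B»` (dag-n09-w3 g6) with §2's clauses; the letter's continuity ON `domAlt_{j+1}` is file 1's `continuousOn_critCfgAxOfRecord_of_thm1_of_reg8`;
solvability at `εreg` on the domain comes down the radius (`ukExists_of_le_of_Uk_mem`).
[cite: Balaban1987RG1, (0.13) p.254, (0.19) p.255, p.259, (2.3) p.265, (2.9) p.266, (2.10) p.267 and p.267; Balaban1985Averaging, Prop. 2 (53) p.26 and (19) p.21; Balaban1985Variational, Thm 1 (6), (8) p.279] -/
theorem regularOn_domAlt_betaInput_chi29Ax_of_thm1_of_reg8 (ν : Stage7Numerics) (ε₂₉ : ℝ) (K : ℕ) (g : ℕ → ℝ) (T : Transport F N) {j : ℕ} (hj : j < K)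
    (hεreg : 0 < ν.εreg)
    (hε3 : (143 * (((((F.P K).d + 4 : ℕ) : ℝ)) ^ 2 / 4) ^ 2) * ν.εreg ≤ 1 / 3)
    (hε2 : 2 * ν.εreg ≤ 2 * deltaSU (Fin N) / ((((F.P K).d + 4) * (F.P K).L : ℕ) : ℝ) ^ 2) (hε29 : 0 < ε₂₉)
    (hn1 : 1640 * (2 * (((((F.P K).d + 2) * (F.P K).L : ℕ) : ℝ) * ε₂₉) +
        ((((F.P K).d + 2) * (F.P K).L : ℕ) : ℝ) ^ 2 / 4 * (2 * ν.εreg / ((F.P K).L : ℝ) ^ 2)) * (((F.P K).L : ℝ) ^ ((F.P K).d - 1)) ^ 2 ≤ 1)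
    (hn2 : 13 * (2 * (((((F.P K).d + 2) * (F.P K).L : ℕ) : ℝ) * ε₂₉) +
        ((((F.P K).d + 2) * (F.P K).L : ℕ) : ℝ) ^ 2 / 4 * (2 * ν.εreg / ((F.P K).L : ℝ) ^ 2)) * ((F.P K).L : ℝ) ^ ((F.P K).d - 1) < deltaSU (Fin N))
    {α : ℝ} (hαB : ((((F.P K).d + 2) * (F.P K).L : ℕ) : ℝ) ^ 2 / 4 *
      (2 * ν.εreg / ((F.P K).L : ℝ) ^ 2 + 4 * max ε₂₉ (10 * (((((F.P K).d + 2) * (F.P K).L : ℕ) : ℝ) * ε₂₉) * ((F.P K).L : ℝ) ^ ((F.P K).d - 1))) < α)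
    (hα24 : α ≤ 1 / 24) (hαδ : α < deltaSU (Fin N)) (hαL : 157 * α < (((F.P K).L : ℝ) ^ ((F.P K).d - 1))⁻¹)
    (hord : 2 * ν.εreg / ((F.P K).L : ℝ) ^ 2 +
      4 * max ε₂₉ (10 * (((((F.P K).d + 2) * (F.P K).L : ℕ) : ℝ) * ε₂₉) * ((F.P K).L : ℝ) ^ ((F.P K).d - 1)) < ν.ε₀)
    {εbg α₀ : ℝ} (hlt : ν.εreg < εbg) (he : ν.εreg < α₀) (hα : 0 < α₀)
    (hα3 : (143 * (((((F.P K).d + 4 : ℕ) : ℝ)) ^ 2 / 4) ^ 2) * α₀ ≤ 1 / 3)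
    (hα2 : 2 * α₀ ≤ 2 * deltaSU (Fin N) / ((((F.P K).d + 4) * (F.P K).L : ℕ) : ℝ) ^ 2)
    (hα24' : ((((F.P K).d + 2) * (F.P K).L : ℕ) : ℝ) ^ 2 / 4 * (2 * α₀) ≤ 1 / 24)
    (hαL' : 157 * (((((F.P K).d + 2) * (F.P K).L : ℕ) : ℝ) ^ 2 / 4 * (2 * α₀)) < (((F.P K).L : ℝ) ^ ((F.P K).d - 1))⁻¹)
    (hfed : ((((F.P K).d * (F.P K).L : ℕ) : ℝ)) ^ 2 / 4 * (2 * ν.εreg / ((F.P K).L : ℝ) ^ 2) < deltaFed (Fin N))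
    (hρm : Measurable (betaInputOfRecord F N T (chiFixed29Ax F N ν ε₂₉) K g j))
    (hint : Integrable (betaInputOfRecord F N T (chiFixed29Ax F N ν ε₂₉) K g j) (fieldMeasure (F.P K) j (SU N)))
    (h11 : ∀ W ∈ domAltOfRecord F N ν K (j + 1), UkExists F N K (j + 1) εbg W ∧ UniqueUkOrbit F N K (j + 1) εbg W)
    (hreg8 : ∀ W ∈ domAltOfRecord F N ν K (j + 1), Uk F N K (j + 1) εbg W ∈ bgReg F N K (j + 1) ν.εreg)
    (hGF : ContinuousOn (gfOfRecord F N K j) (domAltOfRecord F N ν K j))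
    (hA : ContinuousOn (effActionHT F N T (chiFixed29Ax F N ν ε₂₉) K g j) (domAltOfRecord F N ν K j)) :
    domAltOfRecord F N ν K (j + 1) ⊆ regSetOfRecord F N K j (betaInputOfRecord F N T (chiFixed29Ax F N ν ε₂₉) K g j) ∧
      HasContTransportOn F N K j (betaInputOfRecord F N T (chiFixed29Ax F N ν ε₂₉) K g j) (domAltOfRecord F N ν K (j + 1)) := by
  have hL0 : (0 : ℝ) < (F.P K).L := by exact_mod_cast (F.P K).L_pos
  have hsol : ∀ W ∈ domAltOfRecord F N ν K (j + 1), UkExists F N K (j + 1) ν.εreg W :=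
    fun W hW => ukExists_of_le_of_Uk_mem hlt.le (h11 W hW).1 (hreg8 W hW)
  -- the support set `K₀ = «loops ≤ α ∧ plaquettes ≤ B»`, `B = 2εreg∕L² + 4·max(ε₂₉, 10ℓL^{d−1}ε₂₉)`; closed, in the loop guard, inside `domAlt_j` (strict `B < ε₀`)
  have hK₀D : {W : GaugeField (F.P K) j (SU N) | (∀ c i, dist1 (loopHol W c i) ≤ α) ∧ ∀ p, dist1 (GaugeField.plaqHol W p) ≤
      2 * ν.εreg / ((F.P K).L : ℝ) ^ 2 + 4 * max ε₂₉ (10 * (((((F.P K).d + 2) * (F.P K).L : ℕ) : ℝ) * ε₂₉) * ((F.P K).L : ℝ) ^ ((F.P K).d - 1))} ⊆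
      domAltOfRecord F N ν K j :=
    fun W hW => (mem_domAltOfRecord_iff F N ν K j W).2 (plaqSmall_of_mem_of_lt hord W hW)
  have hcrit : ContinuousOn (critCfgAxOfRecord F N ν K j) (domAltOfRecord F N ν K (j + 1)) :=
    continuousOn_critCfgAxOfRecord_of_thm1_of_reg8 ν hj hlt he hα hα3 hα2 hα24' hαL' hεreg hε3 hε2
      (by rw [div_mul_cancel₀ _ (by positivity)]) hfed h11 hreg8
  exact domAlt_subset_regSetOfRecord_of_loopSmall_chi29Ax_local ν ν hj hα24 hαδ hαL hε29.ne' hρm hint (betaInput_chi29Ax_nonneg ν ε₂₉ T K g j)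
    (isClosed_loopLe_inter_plaqLe _ _) (localSupportSet_subset_loopGuard (F := F) (N := N) K j)
    (hρC_betaInput_chi29Ax_of_continuousOn ν ε₂₉ T g (isClosed_loopLe_inter_plaqLe _ _) hK₀D hGF hA)
    (hρK_betaInput_chi29Ax_of_hsol_of_numerics ν hj T g hε29.le hεreg hε3 hε2 hn1 hn2 hαB hsol)
    (hρc_betaInput_chi29Ax_local_of_continuousOn_crit ν ε₂₉ T g (isOpen_domAltOfRecord ν K (j + 1)) (isOpen_domAltOfRecord ν K j) hK₀D hαδ
      (localSupportSet_subset_loopGuard (F := F) (N := N) K j) hcrit hGF hA)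

/-- ★★★ **THE N09 DOORS' ANALYTIC-INCLUSION BINDER `hreg` FOR THE RE-CENTRED β-INPUT AT THE STAGE-13 Ax LETTERS** (`chiβOfRecord₁₃Ax θ = chiFixed29Ax θ.ν θ.ε₂₉`, `rfl`; any transport `T`,
any history `g`; torus `K`): `∀ j < K, domAltOfRecord θ.ν K (j+1) ⊆ regSetOfRecord F N K j ρ_j^{Ax}` from the TOWER-SHAPED two-radii binders `h11`∕`hreg8` (`∀ k ≤ K, ∀ V ∈ domAlt_k, …`,
dag-n09-w1 g2's displayed shapes at `εbg := θ.εbg`), (H-U), (I19), `GF_j`∕`A_j` continuity on `domAlt_j` and the numerics of `regularOn_domAlt_betaInput_chi29Ax_of_thm1_of_reg8`.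
[cite: Balaban1987RG1, p.259, (2.9) p.266, (2.10) p.267 and (0.13) p.254; Balaban1985Variational, Thm 1 (6), (8) p.279] -/
theorem hregAx_of_thm1_εbg_of_reg8 (θ : Stage13Params F N) (K : ℕ) (g : ℕ → ℝ) (T : Transport F N) (hεreg : 0 < θ.ν.εreg)
    (hε3 : (143 * (((((F.P K).d + 4 : ℕ) : ℝ)) ^ 2 / 4) ^ 2) * θ.ν.εreg ≤ 1 / 3)
    (hε2 : 2 * θ.ν.εreg ≤ 2 * deltaSU (Fin N) / ((((F.P K).d + 4) * (F.P K).L : ℕ) : ℝ) ^ 2) (hε29 : 0 < θ.ε₂₉)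
    (hn1 : 1640 * (2 * (((((F.P K).d + 2) * (F.P K).L : ℕ) : ℝ) * θ.ε₂₉) +
        ((((F.P K).d + 2) * (F.P K).L : ℕ) : ℝ) ^ 2 / 4 * (2 * θ.ν.εreg / ((F.P K).L : ℝ) ^ 2)) * (((F.P K).L : ℝ) ^ ((F.P K).d - 1)) ^ 2 ≤ 1)
    (hn2 : 13 * (2 * (((((F.P K).d + 2) * (F.P K).L : ℕ) : ℝ) * θ.ε₂₉) +
        ((((F.P K).d + 2) * (F.P K).L : ℕ) : ℝ) ^ 2 / 4 * (2 * θ.ν.εreg / ((F.P K).L : ℝ) ^ 2)) * ((F.P K).L : ℝ) ^ ((F.P K).d - 1) < deltaSU (Fin N))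
    {α : ℝ} (hαB : ((((F.P K).d + 2) * (F.P K).L : ℕ) : ℝ) ^ 2 / 4 *
      (2 * θ.ν.εreg / ((F.P K).L : ℝ) ^ 2 + 4 * max θ.ε₂₉ (10 * (((((F.P K).d + 2) * (F.P K).L : ℕ) : ℝ) * θ.ε₂₉) * ((F.P K).L : ℝ) ^ ((F.P K).d - 1))) < α)
    (hα24 : α ≤ 1 / 24) (hαδ : α < deltaSU (Fin N)) (hαL : 157 * α < (((F.P K).L : ℝ) ^ ((F.P K).d - 1))⁻¹)
    (hord : 2 * θ.ν.εreg / ((F.P K).L : ℝ) ^ 2 +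
      4 * max θ.ε₂₉ (10 * (((((F.P K).d + 2) * (F.P K).L : ℕ) : ℝ) * θ.ε₂₉) * ((F.P K).L : ℝ) ^ ((F.P K).d - 1)) < θ.ν.ε₀)
    {α₀ : ℝ} (hlt : θ.ν.εreg < θ.εbg) (he : θ.ν.εreg < α₀) (hα : 0 < α₀)
    (hα3 : (143 * (((((F.P K).d + 4 : ℕ) : ℝ)) ^ 2 / 4) ^ 2) * α₀ ≤ 1 / 3)
    (hα2 : 2 * α₀ ≤ 2 * deltaSU (Fin N) / ((((F.P K).d + 4) * (F.P K).L : ℕ) : ℝ) ^ 2)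
    (hα24' : ((((F.P K).d + 2) * (F.P K).L : ℕ) : ℝ) ^ 2 / 4 * (2 * α₀) ≤ 1 / 24)
    (hαL' : 157 * (((((F.P K).d + 2) * (F.P K).L : ℕ) : ℝ) ^ 2 / 4 * (2 * α₀)) < (((F.P K).L : ℝ) ^ ((F.P K).d - 1))⁻¹)
    (hfed : ((((F.P K).d * (F.P K).L : ℕ) : ℝ)) ^ 2 / 4 * (2 * θ.ν.εreg / ((F.P K).L : ℝ) ^ 2) < deltaFed (Fin N))
    (hρm : ∀ j < K, Measurable (betaInputOfRecord F N T (chiβOfRecord₁₃Ax F N θ) K g j))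
    (hint : ∀ j < K, Integrable (betaInputOfRecord F N T (chiβOfRecord₁₃Ax F N θ) K g j) (fieldMeasure (F.P K) j (SU N)))
    (h11 : ∀ k, k ≤ K → ∀ V ∈ domAltOfRecord F N θ.ν K k, UkExists F N K k θ.εbg V ∧ UniqueUkOrbit F N K k θ.εbg V)
    (hreg8 : ∀ k, k ≤ K → ∀ V ∈ domAltOfRecord F N θ.ν K k, Uk F N K k θ.εbg V ∈ bgReg F N K k θ.ν.εreg)
    (hGF : ∀ j < K, ContinuousOn (gfOfRecord F N K j) (domAltOfRecord F N θ.ν K j))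
    (hA : ∀ j < K, ContinuousOn (effActionHT F N T (chiβOfRecord₁₃Ax F N θ) K g j) (domAltOfRecord F N θ.ν K j)) :
    ∀ j < K, domAltOfRecord F N θ.ν K (j + 1) ⊆ regSetOfRecord F N K j (betaInputOfRecord F N T (chiβOfRecord₁₃Ax F N θ) K g j) :=
  fun j hj => (regularOn_domAlt_betaInput_chi29Ax_of_thm1_of_reg8 θ.ν θ.ε₂₉ K g T hj hεreg hε3 hε2 hε29 hn1 hn2 hαB hα24 hαδ hαL hord hlt he hα hα3 hα2 hα24' hαL'
    hfed (hρm j hj) (hint j hj) (h11 (j + 1) hj) (hreg8 (j + 1) hj) (hGF j hj) (hA j hj)).1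

end Summit.QuantumFields.YangMills.BalabanUVNodes.N07RoadBHregChi29AxOfRecord
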